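import Literature.Analysis.FluidPDE.PineauVicolLerayBounds
import Literature.Analysis.FluidPDE.PineauVicolLerayPressure
import Literature.Analysis.FluidPDE.PineauVicolPressureIdentification
import Literature.Analysis.FluidPDE.AncientSimilarityVariables
import HarnessLib

/-!
# Orbit bounds — crux stmt-NavierStokesRegularity-1404
  (`QuantisedSymmetry.PolyhedralDssProfileExists`), line polyhedral_cell,
  stub stub_orbitBounds (N12)

Registered bridge `stub_orbitBounds` (`--supports stmt-NavierStokesRegularity-1404`): for every
Type-I constant `C₀` there is `K = K(C₀) ≥ 0` such that for every classical Navier–Stokes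
solution `(u, p)` (`ν = 1`, `f = 0`) on the open past with `HasTypeIDecay C₀ u`, the Leray orbit
`U = lerayOrbit u` solves the backward Leray system on `ℝ × ℝ³` with the NORMALISED pressure
`P(s, y) = lerayOrbitPressure p s y − lerayOrbitPressure p s 0` (`P(s, 0) = 0`), and the
polynomial bounds taken as hypotheses by the period identities of the line hold:
`(1+|y|)|U| ≤ C₀`, `|DU| ≤ K max{|y|,1}⁻²`, `|D²U| ≤ K max{|y|,1}⁻³`, `|∇P| ≤ K(1+|y|)³`,
`|P| ≤ K(1+|y|)⁴`, `|∂ₛU| ≤ K(1+|y|)³`.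

Proof (Pineau–Vicol 2026, Lemma 7.1, all inputs in the tree's discharge files).
* `(U, lerayOrbitPressure p)` solves the backward Leray system on `univ`
  (`isClassicalNSSolutionOn_Iio_iff_isBackwardLeraySolutionOn`); subtracting `P(s, 0)` keeps it
  (`orbitBounds_normalise`: same gradient, `IsSmoothSpaceTimeOn.sub_apply_zero`).
* Profile bound: `hasTypeIDecay_iff_lerayOrbit`. Derivative bounds (7.2):
  `PineauVicol2026.exists_forall_iteratedFDeriv_lerayOrbit_le` for `n ≤ 3`
  (`orbitBounds_derivs`).
* Pressure: `∇(lerayOrbitPressure p s) = ∇Q[U(s)]` (`orbitBounds_gradient_lerayOrbitPressure_eq`: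
  the translated–rescaled solution `(s', y) ↦ λ u(t₀ + λ²s', λy)`, `λ = e^{−s/2}`, `t₀ = −λ²/2`
  (`IsClassicalNSSolutionOn.nsRescale_translate_zero`) is classical on `[−1, 0)` with the same
  Type-I constant, its slice at `s' = −½` is EXACTLY `U(s)` with pressure slice
  `lerayOrbitPressure p s`, and `PineauVicol2026.gradient_pressure_eq_of_typeI` identifies the
  gradient there); then `‖∇Q[U(s)](y)‖ ≤ K_Q(12K_d² + C₀²(2+|y|)³)`
  (`exists_bound_fderiv_pressurePotential`, `norm_fderiv_pressureSource_le`), i.e.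
  `≤ K_P (1+|y|)³` (`orbitBounds_pressure`).
* `|P(s,y)| ≤ |y| sup_{B̄(0,|y|)} ‖∇P‖ ≤ K_P(1+|y|)⁴` (mean value inequality,
  `orbitBounds_abs_sub_le`); `∂ₛU` from Leray's momentum equation
  (`PineauVicol2026.norm_timeDerivWithin_le_of_leray`, `orbitBounds_timeDeriv_le`).
-/

noncomputable section

-- the summit namespace `…NavierStokesRegularity.NavierStokesRegularity…` is the tree convention (D-0017)
set_option linter.dupNamespace false

namespace Summit.NavierStokesRegularity.NavierStokesRegularity.Theorems.PolyhedralDssProfileExists.PolyhedralCell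

open MeasureTheory Set Function Filter Topology
open Literature.Analysis Literature.Analysis.FluidPDE
open scoped InnerProductSpace RealInnerProductSpace Laplacian ContDiff

-- nested operator types
set_option maxSynthPendingDepth 3

/-! ### The normalised pressure and the Type-I constant -/

/-- **Normalising the pressure keeps the backward Leray system**: `(U, P − P(·, 0))` solves it
whenever `(U, P)` does (the gradient ignores the function of time; joint smoothness by
`IsSmoothSpaceTimeOn.sub_apply_zero`). [folklore] -/
theorem orbitBounds_normalise {S : Set ℝ} {ν : ℝ}
    {U : ℝ → EuclideanSpace ℝ (Fin 3) → EuclideanSpace ℝ (Fin 3)}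
    {P : ℝ → EuclideanSpace ℝ (Fin 3) → ℝ} (h : IsBackwardLeraySolutionOn S ν U P) :
    IsBackwardLeraySolutionOn S ν U (fun s y => P s y - P s 0) where
  smooth_velocity := h.smooth_velocity
  smooth_pressure := h.smooth_pressure.sub_apply_zero
  momentum s hs y := by
    rw [gradient_sub_const]
    exact h.momentum s hs y
  divFree := h.divFree

/-- A Type-I bound forces `0 ≤ C₀` (evaluate at `(t, x) = (−1, 0)`). [folklore] -/
theorem orbitBounds_nonneg {C₀ : ℝ}
    {u : ℝ → EuclideanSpace ℝ (Fin 3) → EuclideanSpace ℝ (Fin 3)} (hI : HasTypeIDecay C₀ u) :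
    0 ≤ C₀ := by
  have h := hI (-1) (by norm_num) 0
  rw [norm_zero, zero_add, neg_neg, Real.sqrt_one, div_one] at h
  exact (norm_nonneg _).trans h

/-! ### The pressure gradient in Leray variables is the gradient of the Riesz potential -/

/-- **`∇(lerayOrbitPressure p s) = ∇Q[U(s)]` for a classical Type-I solution on the past.**
The translated–rescaled pair `(s', y) ↦ (λ u(t₀ + λ²s', λy), λ² p(t₀ + λ²s', λy))`,
`λ = e^{−s/2}`, `t₀ = −λ²/2`, is a classical solution on `[−1, 0)` with the Type-I bound of
constant `C₀`; its slices at `s' = −½` are `U(s)` and `lerayOrbitPressure p s`, so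
`PineauVicol2026.gradient_pressure_eq_of_typeI` (Tao's pressure normalisation on the decay
class) gives the claim. [cite: PineauVicol2026, Lemma 7.1] -/
theorem orbitBounds_gradient_lerayOrbitPressure_eq {C₀ : ℝ}
    {u : ℝ → EuclideanSpace ℝ (Fin 3) → EuclideanSpace ℝ (Fin 3)}
    {p : ℝ → EuclideanSpace ℝ (Fin 3) → ℝ} (hsol : IsClassicalNSSolutionOn (Iio 0) 1 0 u p)
    (hI : HasTypeIDecay C₀ u) (s : ℝ) (y : EuclideanSpace ℝ (Fin 3)) :
    gradient (lerayOrbitPressure p s) y = gradient (pressurePotential (lerayOrbit u s)) y := by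
  have hC₀ : 0 ≤ C₀ := orbitBounds_nonneg hI
  obtain ⟨lam, hlam⟩ : ∃ lam : ℝ, lam = Real.exp (-s / 2) := ⟨_, rfl⟩
  have hlam0 : 0 < lam := by rw [hlam]; exact Real.exp_pos _
  have hlam2 : lam ^ 2 = Real.exp (-s) := by rw [hlam]; exact exp_neg_half_sq s
  obtain ⟨t₀, ht₀⟩ : ∃ t₀ : ℝ, t₀ = -lam ^ 2 / 2 := ⟨_, rfl⟩
  have hl2 : 0 < lam ^ 2 := pow_pos hlam0 2
  have ht₀0 : t₀ < 0 := by rw [ht₀]; linarith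
  -- the translated and rescaled solution on `[−1, 0)`
  have h2 := hsol.nsRescale_translate_zero hlam0 t₀ 0
  have hsub : Ico (-1 : ℝ) 0 ⊆ (fun r => t₀ + lam ^ 2 * r) ⁻¹' Iio 0 := fun r hr => by
    show t₀ + lam ^ 2 * r < 0
    have : lam ^ 2 * r ≤ 0 := mul_nonpos_of_nonneg_of_nonpos hl2.le hr.2.le
    linarith
  have h3 := h2.mono hsub (uniqueDiffOn_Ico (-1) 0)
  have hI3 : ∀ r ∈ Ico (-1 : ℝ) 0, ∀ x : EuclideanSpace ℝ (Fin 3),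
      ‖(lam • stPull (lam ^ 2) lam t₀ 0 u) r x‖ ≤ C₀ / (‖x‖ + Real.sqrt (-r)) := by
    intro r hr x
    have hr0 : r < 0 := hr.2
    have hτ : t₀ + lam ^ 2 * r < 0 := hsub hr
    have key := hI (t₀ + lam ^ 2 * r) hτ (lam • x)
    simp only [Pi.smul_apply, stPull_apply, zero_add]
    rw [norm_smul, Real.norm_of_nonneg hlam0.le]
    have hsq : lam * Real.sqrt (-r) ≤ Real.sqrt (-(t₀ + lam ^ 2 * r)) := by
      have e : lam * Real.sqrt (-r) = Real.sqrt (lam ^ 2 * (-r)) := by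
        rw [Real.sqrt_mul hl2.le, Real.sqrt_sq hlam0.le]
      rw [e]
      exact Real.sqrt_le_sqrt (by linarith)
    have hden : lam * (‖x‖ + Real.sqrt (-r)) ≤ ‖lam • x‖ + Real.sqrt (-(t₀ + lam ^ 2 * r)) := by
      rw [norm_smul, Real.norm_of_nonneg hlam0.le, mul_add]
      exact add_le_add le_rfl hsq
    have hpos : 0 < lam * (‖x‖ + Real.sqrt (-r)) :=
      mul_pos hlam0 (add_pos_of_nonneg_of_pos (norm_nonneg _) (Real.sqrt_pos.2 (neg_pos.2 hr0)))
    calc lam * ‖u (t₀ + lam ^ 2 * r) (lam • x)‖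
        ≤ lam * (C₀ / (‖lam • x‖ + Real.sqrt (-(t₀ + lam ^ 2 * r)))) :=
          mul_le_mul_of_nonneg_left key hlam0.le
      _ ≤ lam * (C₀ / (lam * (‖x‖ + Real.sqrt (-r)))) :=
          mul_le_mul_of_nonneg_left (div_le_div_of_nonneg_left hC₀ hpos hden) hlam0.le
      _ = C₀ / (‖x‖ + Real.sqrt (-r)) := by
          rw [← mul_div_assoc, mul_div_mul_left _ _ hlam0.ne']
  have key := PineauVicol2026.gradient_pressure_eq_of_typeI h3 hI3 (t := -1 / 2)
    ⟨by norm_num, by norm_num⟩ y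
  have ht : t₀ + lam ^ 2 * (-1 / 2) = -Real.exp (-s) := by rw [← hlam2, ht₀]; ring
  have hu : (lam • stPull (lam ^ 2) lam t₀ 0 u) (-1 / 2) = lerayOrbit u s := by
    funext x
    simp only [Pi.smul_apply, stPull_apply, zero_add]
    rw [ht, lerayOrbit_apply, ← hlam]
  have hp : (lam ^ 2 • stPull (lam ^ 2) lam t₀ 0 p) (-1 / 2) = lerayOrbitPressure p s := by
    funext x
    simp only [Pi.smul_apply, stPull_apply, zero_add, smul_eq_mul]
    rw [ht, lerayOrbitPressure_apply, ← hlam, ← hlam2]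
  rw [hu, hp] at key
  exact key

/-! ### Derivative bounds (7.2) and the pressure gradient bound -/

/-- **Derivative bounds of the orbit** (Lemma 7.1, (7.2), `n ≤ 3`): one constant `K_d(C₀)` with
`‖DᵏU(s)(y)‖ ≤ K_d` for `k ≤ 3`, `‖DU(s)(y)‖ ≤ K_d max{|y|,1}⁻²`,
`‖D²U(s)(y)‖ ≤ K_d max{|y|,1}⁻³` for every Type-I classical solution of constant `C₀`. [cite: PineauVicol2026, Lemma 7.1, (7.2)] -/
theorem orbitBounds_derivs (C₀ : ℝ) : ∃ Kd : ℝ, 0 ≤ Kd ∧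
    ∀ (u : ℝ → EuclideanSpace ℝ (Fin 3) → EuclideanSpace ℝ (Fin 3))
      (p : ℝ → EuclideanSpace ℝ (Fin 3) → ℝ),
      IsClassicalNSSolutionOn (Iio 0) 1 0 u p → HasTypeIDecay C₀ u →
      ∀ (s : ℝ) (y : EuclideanSpace ℝ (Fin 3)),
        (∀ k ≤ 3, ‖iteratedFDeriv ℝ k (lerayOrbit u s) y‖ ≤ Kd) ∧
        ‖fderiv ℝ (lerayOrbit u s) y‖ ≤ Kd * ((max ‖y‖ 1)⁻¹) ^ 2 ∧
        ‖iteratedFDeriv ℝ 2 (lerayOrbit u s) y‖ ≤ Kd * ((max ‖y‖ 1)⁻¹) ^ 3 := by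
  obtain ⟨K₀, hK₀0, hK₀⟩ := PineauVicol2026.exists_forall_iteratedFDeriv_lerayOrbit_le 0 C₀
  obtain ⟨K₁, hK₁0, hK₁⟩ := PineauVicol2026.exists_forall_iteratedFDeriv_lerayOrbit_le 1 C₀
  obtain ⟨K₂, hK₂0, hK₂⟩ := PineauVicol2026.exists_forall_iteratedFDeriv_lerayOrbit_le 2 C₀
  obtain ⟨K₃, hK₃0, hK₃⟩ := PineauVicol2026.exists_forall_iteratedFDeriv_lerayOrbit_le 3 C₀
  refine ⟨K₀ + K₁ + K₂ + K₃, by positivity, fun u p hsol hI s y => ?_⟩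
  have hI' : ∀ t ∈ Iio (0 : ℝ), ∀ x, ‖u t x‖ ≤ C₀ / (‖x‖ + Real.sqrt (-t)) :=
    fun t ht x => hI t ht x
  have hm1 : (max ‖y‖ 1)⁻¹ ≤ 1 := inv_le_one_of_one_le₀ (le_max_right _ _)
  have hmk : ∀ k : ℕ, ((max ‖y‖ 1)⁻¹) ^ k ≤ 1 := fun k => pow_le_one₀ (by positivity) hm1
  have h0 := hK₀ u p hsol hI' s y
  have h1 := hK₁ u p hsol hI' s y
  have h2 := hK₂ u p hsol hI' s y
  have h3 := hK₃ u p hsol hI' s y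
  refine ⟨fun k hk => ?_, ?_, ?_⟩
  · interval_cases k
    · exact h0.trans ((mul_le_of_le_one_right hK₀0 (hmk _)).trans (by linarith))
    · exact h1.trans ((mul_le_of_le_one_right hK₁0 (hmk _)).trans (by linarith))
    · exact h2.trans ((mul_le_of_le_one_right hK₂0 (hmk _)).trans (by linarith))
    · exact h3.trans ((mul_le_of_le_one_right hK₃0 (hmk _)).trans (by linarith))
  · rw [← norm_iteratedFDeriv_one]
    exact h1.trans (mul_le_mul_of_nonneg_right (by linarith) (by positivity))
  · exact h2.trans (mul_le_mul_of_nonneg_right (by linarith) (by positivity))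

/-- **Pressure gradient bound in Leray variables** (Lemma 7.1: `∇P` grows at most cubically):
one constant `K_P(C₀)` with `‖∇(lerayOrbitPressure p s)(y)‖ ≤ K_P (1+|y|)³` for every Type-I
classical solution of constant `C₀` (`∇(lerayOrbitPressure p s) = ∇Q[U(s)]` and the gradient
bound for the potential on the decay class with source gradient `≤ 12K_d²`). [cite: PineauVicol2026, Lemma 7.1] -/
theorem orbitBounds_pressure (C₀ : ℝ) : ∃ KP : ℝ, 0 ≤ KP ∧
    ∀ (u : ℝ → EuclideanSpace ℝ (Fin 3) → EuclideanSpace ℝ (Fin 3))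
      (p : ℝ → EuclideanSpace ℝ (Fin 3) → ℝ),
      IsClassicalNSSolutionOn (Iio 0) 1 0 u p → HasTypeIDecay C₀ u →
      ∀ (s : ℝ) (y : EuclideanSpace ℝ (Fin 3)),
        ‖gradient (lerayOrbitPressure p s) y‖ ≤ KP * (1 + ‖y‖) ^ 3 := by
  obtain ⟨Kd, hKd0, hKd⟩ := orbitBounds_derivs C₀
  obtain ⟨KQ, hKQ0, hKQ⟩ := PineauVicol2026.exists_bound_fderiv_pressurePotential
  refine ⟨KQ * (12 * Kd ^ 2 + 8 * C₀ ^ 2), by positivity, fun u p hsol hI s y => ?_⟩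
  have hBL : IsBackwardLeraySolutionOn univ 1 (lerayOrbit u) (lerayOrbitPressure p) :=
    isClassicalNSSolutionOn_Iio_iff_isBackwardLeraySolutionOn.1 hsol
  have hU3 : ContDiff ℝ 3 (lerayOrbit u s) := contDiff_infty.1 (hBL.contDiff_velocity (mem_univ s)) 3
  have hdiv : VectorCalculus.IsDivFree (lerayOrbit u s) := hBL.divFree s (mem_univ s)
  have hdec : ∀ z, ‖lerayOrbit u s z‖ ≤ C₀ / (1 + ‖z‖) := fun z => by
    rw [le_div_iff₀ (by positivity), mul_comm]
    exact hasTypeIDecay_iff_lerayOrbit.1 hI s z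
  have hDk : ∀ k ≤ 3, ∀ z, ‖iteratedFDeriv ℝ k (lerayOrbit u s) z‖ ≤ Kd :=
    fun k hk z => (hKd u p hsol hI s z).1 k hk
  have hsrc : ∀ z, ‖fderiv ℝ (pressureSource (lerayOrbit u s)) z‖ ≤ 12 * Kd ^ 2 :=
    PineauVicol2026.norm_fderiv_pressureSource_le hU3 hdiv hDk
  have hQ := hKQ (lerayOrbit u s) C₀ (12 * Kd ^ 2) hU3 hdec (by positivity) hsrc y
  rw [orbitBounds_gradient_lerayOrbitPressure_eq hsol hI s y, gradient,
    LinearIsometryEquiv.norm_map]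
  refine hQ.trans ?_
  have hr := norm_nonneg y
  have h1 : (2 + ‖y‖) ^ 3 ≤ 8 * (1 + ‖y‖) ^ 3 :=
    calc (2 + ‖y‖) ^ 3 ≤ (2 * (1 + ‖y‖)) ^ 3 := pow_le_pow_left₀ (by positivity) (by linarith) 3
      _ = 8 * (1 + ‖y‖) ^ 3 := by ring
  have h2 : (1 : ℝ) ≤ (1 + ‖y‖) ^ 3 := one_le_pow₀ (by linarith)
  have h3 : 12 * Kd ^ 2 ≤ 12 * Kd ^ 2 * (1 + ‖y‖) ^ 3 := le_mul_of_one_le_right (by positivity) h2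
  have h4 : C₀ ^ 2 * (2 + ‖y‖) ^ 3 ≤ C₀ ^ 2 * (8 * (1 + ‖y‖) ^ 3) :=
    mul_le_mul_of_nonneg_left h1 (sq_nonneg _)
  calc KQ * (12 * Kd ^ 2 + C₀ ^ 2 * (2 + ‖y‖) ^ 3)
      ≤ KQ * (12 * Kd ^ 2 * (1 + ‖y‖) ^ 3 + C₀ ^ 2 * (8 * (1 + ‖y‖) ^ 3)) :=
        mul_le_mul_of_nonneg_left (add_le_add h3 h4) hKQ0
    _ = KQ * (12 * Kd ^ 2 + 8 * C₀ ^ 2) * (1 + ‖y‖) ^ 3 := by ring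

/-! ### The pointwise pressure bound and `∂ₛU` -/

/-- **Mean value inequality**: if `‖∇f(z)‖ ≤ A(1+|z|)³` everywhere, then
`|f(y) − f(0)| ≤ A(1+|y|)⁴` (the bound on the ball `B̄(0, |y|)` times `|y| ≤ 1 + |y|`). [folklore] -/
theorem orbitBounds_abs_sub_le {f : EuclideanSpace ℝ (Fin 3) → ℝ} {A : ℝ}
    (hf : Differentiable ℝ f) (hA : 0 ≤ A)
    (hg : ∀ z, ‖gradient f z‖ ≤ A * (1 + ‖z‖) ^ 3) (y : EuclideanSpace ℝ (Fin 3)) :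
    |f y - f 0| ≤ A * (1 + ‖y‖) ^ 4 := by
  have hb : ∀ z ∈ Metric.closedBall (0 : EuclideanSpace ℝ (Fin 3)) ‖y‖,
      ‖fderiv ℝ f z‖ ≤ A * (1 + ‖y‖) ^ 3 := fun z hz => by
    have e : ‖gradient f z‖ = ‖fderiv ℝ f z‖ := by rw [gradient, LinearIsometryEquiv.norm_map]
    have hz' : ‖z‖ ≤ ‖y‖ := mem_closedBall_zero_iff.1 hz
    rw [← e]
    exact (hg z).trans (mul_le_mul_of_nonneg_left
      (pow_le_pow_left₀ (by positivity) (by linarith) 3) hA)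
  have key := (convex_closedBall (0 : EuclideanSpace ℝ (Fin 3)) ‖y‖).norm_image_sub_le_of_norm_fderiv_le
    (fun z _ => hf z) hb (Metric.mem_closedBall_self (norm_nonneg y))
    (mem_closedBall_zero_iff.2 le_rfl)
  rw [sub_zero, Real.norm_eq_abs] at key
  refine key.trans ?_
  have hy : ‖y‖ ≤ 1 + ‖y‖ := by linarith [norm_nonneg y]
  calc A * (1 + ‖y‖) ^ 3 * ‖y‖ ≤ A * (1 + ‖y‖) ^ 3 * (1 + ‖y‖) :=
        mul_le_mul_of_nonneg_left hy (by positivity)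
    _ = A * (1 + ‖y‖) ^ 4 := by ring

/-- **`∂ₛU` from Leray's momentum equation** (the (7.1) input): for a solution of the backward
Leray system on `ℝ × ℝ³` with `‖U(s,y)‖ ≤ C₀`, `‖DU(s)(y)‖ ≤ K_d max{|y|,1}⁻²`,
`‖D²U(s)(y)‖ ≤ K_d` and `‖∇P(s)(y)‖ ≤ K_P(1+|y|)³`,
`‖∂ₛU(s,y)‖ ≤ (4K_d + C₀ + K_dC₀ + K_P)(1+|y|)³`. [cite: PineauVicol2026, Lemma 7.1] -/
theorem orbitBounds_timeDeriv_le
    {U : ℝ → EuclideanSpace ℝ (Fin 3) → EuclideanSpace ℝ (Fin 3)}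
    {P : ℝ → EuclideanSpace ℝ (Fin 3) → ℝ} (h : IsBackwardLeraySolutionOn univ 1 U P)
    {C₀ Kd KP : ℝ} {s : ℝ} {y : EuclideanSpace ℝ (Fin 3)} (h0 : ‖U s y‖ ≤ C₀)
    (h1 : ‖fderiv ℝ (U s) y‖ ≤ Kd * ((max ‖y‖ 1)⁻¹) ^ 2) (h2 : ‖iteratedFDeriv ℝ 2 (U s) y‖ ≤ Kd)
    (hP : ‖gradient (P s) y‖ ≤ KP * (1 + ‖y‖) ^ 3) (hKd : 0 ≤ Kd) (hC₀ : 0 ≤ C₀) :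
    ‖timeDeriv U s y‖ ≤ (4 * Kd + C₀ + Kd * C₀ + KP) * (1 + ‖y‖) ^ 3 := by
  have hT := PineauVicol2026.norm_timeDerivWithin_le_of_leray h (mem_univ s) y
  rw [← timeDeriv_eq_timeDerivWithin_univ] at hT
  have hm0 : 0 < max ‖y‖ 1 := lt_max_of_lt_right one_pos
  have hm1 : 1 ≤ max ‖y‖ 1 := le_max_right _ _
  have hym : ‖y‖ ≤ max ‖y‖ 1 := le_max_left _ _
  have hinv : (max ‖y‖ 1)⁻¹ ≤ 1 := inv_le_one_of_one_le₀ hm1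
  have hDU : ‖fderiv ℝ (U s) y‖ ≤ Kd :=
    h1.trans (mul_le_of_le_one_right hKd (pow_le_one₀ (by positivity) hinv))
  have hy1 : ‖fderiv ℝ (U s) y‖ * ‖y‖ ≤ Kd := by
    have hne : max ‖y‖ 1 ≠ 0 := hm0.ne'
    calc ‖fderiv ℝ (U s) y‖ * ‖y‖ ≤ Kd * ((max ‖y‖ 1)⁻¹) ^ 2 * max ‖y‖ 1 :=
          mul_le_mul h1 hym (norm_nonneg _) (by positivity)
      _ = Kd * (max ‖y‖ 1)⁻¹ := by field_simp
      _ ≤ Kd * 1 := mul_le_mul_of_nonneg_left hinv hKd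
      _ = Kd := mul_one _
  have hprod : ‖fderiv ℝ (U s) y‖ * ‖U s y‖ ≤ Kd * C₀ := mul_le_mul hDU h0 (norm_nonneg _) hKd
  have hcube : (1 : ℝ) ≤ (1 + ‖y‖) ^ 3 := one_le_pow₀ (by linarith [norm_nonneg y])
  have hc : 4 * Kd + C₀ + Kd * C₀ ≤ (4 * Kd + C₀ + Kd * C₀) * (1 + ‖y‖) ^ 3 :=
    le_mul_of_one_le_right (by positivity) hcube
  calc ‖timeDeriv U s y‖
      ≤ 3 * ‖iteratedFDeriv ℝ 2 (U s) y‖ + (1 / 2) * ‖U s y‖ +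
          (1 / 2) * (‖fderiv ℝ (U s) y‖ * ‖y‖) + ‖fderiv ℝ (U s) y‖ * ‖U s y‖ +
          ‖gradient (P s) y‖ := hT
    _ ≤ 3 * Kd + (1 / 2) * C₀ + (1 / 2) * Kd + Kd * C₀ + KP * (1 + ‖y‖) ^ 3 := by
        gcongr
    _ ≤ (4 * Kd + C₀ + Kd * C₀) + KP * (1 + ‖y‖) ^ 3 := by nlinarith
    _ ≤ (4 * Kd + C₀ + Kd * C₀) * (1 + ‖y‖) ^ 3 + KP * (1 + ‖y‖) ^ 3 := by linarith
    _ = (4 * Kd + C₀ + Kd * C₀ + KP) * (1 + ‖y‖) ^ 3 := by ring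

/-! ### The registered stub -/

/-- **Stub N12 `stub_orbitBounds` (Pineau–Vicol 2026, Lemma 7.1, on the crux's class).** For every
`C₀` there is `K = K(C₀) ≥ 0` such that for every classical solution `(u, p)` of Navier–Stokes
(`ν = 1`, `f = 0`) on the open past with `HasTypeIDecay C₀ u`, the Leray orbit `U = lerayOrbit u`
solves the backward Leray system on `ℝ × ℝ³` with a pressure `P` normalised by `P(s, 0) = 0`,
and `(1+|y|)|U| ≤ C₀`, `|DU| ≤ K max{|y|,1}⁻²`, `|D²U| ≤ K max{|y|,1}⁻³`, `|∇P| ≤ K(1+|y|)³`,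
`|P| ≤ K(1+|y|)⁴`, `|∂ₛU| ≤ K(1+|y|)³` — the hypotheses of the period-averaged identities of
the line (stub N10). [cite: PineauVicol2026, Lemma 7.1] -/
theorem stub_orbitBounds :
    ∀ C₀ : ℝ, ∃ K : ℝ, 0 ≤ K ∧
      ∀ (u : ℝ → EuclideanSpace ℝ (Fin 3) → EuclideanSpace ℝ (Fin 3)) (p : ℝ → EuclideanSpace ℝ (Fin 3) → ℝ),
        IsClassicalNSSolutionOn (Set.Iio 0) 1 0 u p → HasTypeIDecay C₀ u →
        ∃ P : ℝ → EuclideanSpace ℝ (Fin 3) → ℝ,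
          IsBackwardLeraySolutionOn Set.univ 1 (lerayOrbit u) P ∧ (∀ s, P s 0 = 0) ∧
          ∀ s y, (1 + ‖y‖) * ‖lerayOrbit u s y‖ ≤ C₀ ∧
            ‖fderiv ℝ (lerayOrbit u s) y‖ ≤ K * ((max ‖y‖ 1)⁻¹) ^ 2 ∧
            ‖iteratedFDeriv ℝ 2 (lerayOrbit u s) y‖ ≤ K * ((max ‖y‖ 1)⁻¹) ^ 3 ∧
            ‖gradient (P s) y‖ ≤ K * (1 + ‖y‖) ^ 3 ∧ |P s y| ≤ K * (1 + ‖y‖) ^ 4 ∧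
            ‖timeDeriv (lerayOrbit u) s y‖ ≤ K * (1 + ‖y‖) ^ 3 := by
  intro C₀
  obtain ⟨Kd, hKd0, hKd⟩ := orbitBounds_derivs C₀
  obtain ⟨KP, hKP0, hKP⟩ := orbitBounds_pressure C₀
  refine ⟨4 * Kd + |C₀| + Kd * |C₀| + KP, by positivity, fun u p hsol hI => ?_⟩
  have hC₀ : 0 ≤ C₀ := orbitBounds_nonneg hI
  have habs : |C₀| = C₀ := abs_of_nonneg hC₀
  have hBL : IsBackwardLeraySolutionOn univ 1 (lerayOrbit u) (lerayOrbitPressure p) :=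
    isClassicalNSSolutionOn_Iio_iff_isBackwardLeraySolutionOn.1 hsol
  have hBLP := orbitBounds_normalise hBL
  refine ⟨fun s y => lerayOrbitPressure p s y - lerayOrbitPressure p s 0, hBLP,
    fun s => sub_self _, fun s y => ?_⟩
  obtain ⟨-, hD1, hD2⟩ := hKd u p hsol hI s y
  have hGP : ∀ z, ‖gradient (lerayOrbitPressure p s) z‖ ≤ KP * (1 + ‖z‖) ^ 3 :=
    hKP u p hsol hI s
  have hprof := hasTypeIDecay_iff_lerayOrbit.1 hI s y
  have hU0 : ‖lerayOrbit u s y‖ ≤ C₀ := hI.norm_lerayOrbit_le' s y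
  have hKle : Kd ≤ 4 * Kd + |C₀| + Kd * |C₀| + KP := by
    have : 0 ≤ Kd * |C₀| := by positivity
    linarith [abs_nonneg C₀]
  have hKPle : KP ≤ 4 * Kd + |C₀| + Kd * |C₀| + KP := by
    have : 0 ≤ Kd * |C₀| := by positivity
    linarith [abs_nonneg C₀]
  have hgrad : gradient (fun z => lerayOrbitPressure p s z - lerayOrbitPressure p s 0) y =
      gradient (lerayOrbitPressure p s) y := gradient_sub_const _ _ y
  have hGP' : ‖gradient (fun z => lerayOrbitPressure p s z - lerayOrbitPressure p s 0) y‖ ≤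
      KP * (1 + ‖y‖) ^ 3 := by
    rw [hgrad]; exact hGP y
  refine ⟨hprof, ?_, ?_, ?_, ?_, ?_⟩
  · exact hD1.trans (mul_le_mul_of_nonneg_right hKle (by positivity))
  · exact hD2.trans (mul_le_mul_of_nonneg_right hKle (by positivity))
  · exact hGP'.trans (mul_le_mul_of_nonneg_right hKPle (by positivity))
  · have hdiff : Differentiable ℝ (lerayOrbitPressure p s) :=
      (hBL.contDiff_pressure (mem_univ s)).differentiable (by simp)
    exact (orbitBounds_abs_sub_le hdiff hKP0 hGP y).trans
      (mul_le_mul_of_nonneg_right hKPle (by positivity))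
  · have hD2' : ‖iteratedFDeriv ℝ 2 (lerayOrbit u s) y‖ ≤ Kd :=
      hD2.trans (mul_le_of_le_one_right hKd0
        (pow_le_one₀ (by positivity) (inv_le_one_of_one_le₀ (le_max_right _ _))))
    have key := orbitBounds_timeDeriv_le hBLP hU0 hD1 hD2' hGP' hKd0 hC₀
    rw [habs]
    exact key

end Summit.NavierStokesRegularity.NavierStokesRegularity.Theorems.PolyhedralDssProfileExists.PolyhedralCell

end
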